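import Summits.QuantumFields.BalabanUV.T4Continuum.Support.AveragingDeficitDerivCore

/-!
# AveragingDeficitDerivAssembly (T⁴ programme, node NE3, row NE3-R2) — β ⇐ CoarseCore: THE DERIVATIVE WALL OF THE
# NE3 ENERGY ROUTE REDUCED, IN THE KERNEL, TO THE PER-PLAQUETTE CORE ESTIMATE (file 2/2 of the assembly)

`deficitDerivWall_of_coarseCore : 1 ≤ L → 0 ≤ c₁ → 0 ≤ c₂ → 512(d+1)(d+4)L²a₀ ≤ 1 → CoarseCore d N L c₁ c₂ a₀ R_b →
DeficitDerivWall d N L (assemblyConst d L c₁ c₂ R_b) a₀ (wallRad d L R_b)`.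
Honest framing, the shape of `CoarseCore` and why, citation header and placement: header of `AveragingDeficitDerivCore`
(file 1/2).  β = `T4AveragingDeficitWall.DeficitDerivWall` (GAPS G-ne3p2-1) is NOT proved here: this file proves it FROM
`CoarseCore`, which is this unit's own typed obligation (asserted nowhere).  What the kernel certifies here is the whole
GLOBAL layer of β: (i) the derivative `D` of the deficit on ANY window pair is `L^{d−4}Σ_{P∈W_c} t_P − Σ_{p∈W_f} t′_p`
(sum rule + uniqueness of derivatives; the tree's `differentiableAt_val_chol_vary` / `hasDerivAt_wt_fhol_vary`); (ii)
EVENTUALITY: for `W ⊇ (pSet, fSet)` of the support every other term vanishes (locality, file 1 §2), so `D` is a FIXED finite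
sum — the `∀ᶠ W in atTop` of β is `Filter.eventually_ge_atTop`; (iii) THE EXACT CANCELLATION of the fine main term
`Σ_p Re tr((d_Vψ)(p)F(p))` against the stencil diagonals `L^{d−4}·L^{2−d}·Σ_P Σ_{k} Re tr(G_kF_k)` (every fine plaquette in
exactly `L²` stencils: `AveragingDeficitCounting.sum_stencil_sum_eq`; `L^{d−4}L^{2−d}L² = 1`); (iv) the fine-side
Wilson-weight pairing `|Re tr(G·V(∂p)) − Re tr(G·F(p))| ≤ 4a²‖G‖` (`AveragingDeficitNearIdentity.abs_nReTr_mul_sub_mul_mlog_le`,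
`G` skew by `curl_mem_skewAdjoint`); (v) the three double-counting dominations (file 1 §4) turning the summed local
right-hand sides into `C·(√gradFluxSq·√curlSq + a²(dirL1 + curlL1))` on `nbhd (wallRad) (bondSites S)`.  NE3 stays
COND-free; finite-T⁴ rung (B)+1; NOT infinite volume / mass gap / Clay / summit progress.  Record: HOME `t4/T4-EST-NE3-R2.md`.
-/

set_option autoImplicit false

open scoped BigOperators Matrix Matrix.Norms.L2Operator Topology
open NormedSpace Finset Filter

namespace Summit.QuantumFields.BalabanUV.T4Continuum.AveragingDeficitDerivAssembly

open Literature.MathematicalPhysics.QuantumFieldTheory.Balaban1983to89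
open B7Prop1Explicit B7Prop2Explicit MatrixLog UnitaryModel
open T4AveragingDeficitWall hiding Site Plane Plaq Bond
open T4AveragingDeficitWallBoundary (stencilIdx stencilOff card_stencilIdx)
open T4AveragingDeficitNonAbelian (small_a_le)
open AveragingDeficitTransport AveragingDeficitLocality AveragingDeficitNearIdentity AveragingDeficitCounting
open AveragingDeficitDerivCore

noncomputable section

variable {d : ℕ} {n : Type*} [Fintype n] [DecidableEq n] [Nonempty n]

local notation "𝕄" => Matrix n n ℂ
local notation "Site" => B7Prop1Explicit.Site
local notation "Plane" => T4AveragingDeficitWall.Plane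
local notation "Plaq" => T4AveragingDeficitWall.Plaq
local notation "Bond" => T4AveragingDeficitWall.Bond

/-- The constant of β produced by the assembly from the core constants `c₁, c₂` and the box radius `R_b`. [folklore] -/
def assemblyConst (d L : ℕ) (c₁ c₂ : ℝ) (Rb : ℕ) : ℝ :=
  (L : ℝ) ^ ((d : ℤ) - 4) * (c₁ * Real.sqrt ((L : ℝ) ^ (d + 4) * (((2 * Rb + 1 : ℕ) : ℝ) ^ (2 * d) * d))
    + c₂ * ((Fintype.card (T4AveragingDeficitWall.Plane d) : ℝ) * (2 * Rb + 1) ^ d + (L : ℝ) ^ 2)) + 4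

/-- The fine set of a support: corners within `ℓ^∞`-distance `4`, all planes. [folklore] -/
def fSet (S : Finset (Bond d)) : Finset (Plaq d) := nbhd 4 (bondSites S) ×ˢ Finset.univ

/-- The coarse set of a support: `ySet × all planes`. [folklore] -/
def pSet (L : ℕ) (S : Finset (Bond d)) : Finset (Plaq d) := ySet L S ×ˢ Finset.univ

omit [Nonempty n] in
/-- The fine main-term density `m(p) = Re tr((d_Vψ)(p)·F(p))` vanishes off `fSet`. [folklore] -/
theorem pair_eq_zero_of_not_mem (V : Site d → Fin d → 𝕄ˣ) {ψ : Site d → Fin d → 𝕄} {S : Finset (Bond d)}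
    (hS : SupportedOn ψ S) (π : Plane d) {x : Site d} (hx : x ∉ nbhd 4 (bondSites S)) :
    nReTr (curl V ψ (x, π) * flux V (x, π)) = 0 := by
  rw [curl_eq_zero_of_far V hS π hx, zero_mul]
  simp [nReTr]

omit [Nonempty n] in
/-- **THE EXACT `L²`-FOLD COVERING OF THE FINE MAIN TERM BY THE STENCIL DIAGONALS.** [folklore] -/
theorem sum_stencilPair_eq (L : ℕ) (hL : 1 ≤ L) (V : Site d → Fin d → 𝕄ˣ) {ψ : Site d → Fin d → 𝕄}
    {S : Finset (Bond d)} (hS : SupportedOn ψ S) :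
    ∑ P ∈ pSet L S, stencilPair L V ψ P.1 P.2
      = (L : ℝ) ^ 2 * ∑ p ∈ fSet S, nReTr (curl V ψ p * flux V p) := by
  unfold pSet fSet
  rw [Finset.sum_product', Finset.sum_product]
  conv_lhs => rw [Finset.sum_comm]
  conv_rhs => rw [Finset.sum_comm, Finset.mul_sum]
  refine Finset.sum_congr rfl fun π _ => ?_
  unfold stencilPair stencilPlaq
  refine sum_stencil_sum_eq L hL (ySet L S) (nbhd 4 (bondSites S)) (fun x => nReTr (curl V ψ (x, π) * flux V (x, π)))
    (fun x hx => pair_eq_zero_of_not_mem V hS π hx) π.1.1 π.1.2 fun x hx i hi j hj => ?_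
  refine mem_blockSites_ySet L hL
    (nbhd_mono (show 4 + 2 * (L - 1) ≤ yRad d L by unfold yRad; omega) _ (mem_nbhd_of_mem_box hx ?_))
  have h := shift_mem_box L x π.1.1 π.1.2 (Finset.mem_range.mp hi) (Finset.mem_range.mp hj) (-1) (Or.inr rfl)
  rw [neg_one_smul, ← sub_eq_add_neg, sub_add_eq_sub_sub] at h
  exact h

/-- Real bookkeeping for the last step of the assembly. [folklore] -/
private theorem assembly_aux {Lp c₁ c₂ S K₁ L2 Q a2 dir cur C : ℝ} (hQ : 0 ≤ Q) (hdir : 0 ≤ a2 * dir)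
    (hcur : 0 ≤ a2 * cur) (hC1 : Lp * c₁ * S ≤ C) (hC2 : Lp * c₂ * K₁ ≤ C) (hC3 : Lp * c₂ * L2 + 4 ≤ C) :
    Lp * (c₁ * (S * Q) + c₂ * a2 * (K₁ * dir + L2 * cur)) + 4 * a2 * cur ≤ C * (Q + a2 * (dir + cur)) := by
  have e : Lp * (c₁ * (S * Q) + c₂ * a2 * (K₁ * dir + L2 * cur)) + 4 * a2 * cur
      = (Lp * c₁ * S) * Q + (Lp * c₂ * K₁) * (a2 * dir) + (Lp * c₂ * L2 + 4) * (a2 * cur) := by ring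
  rw [e]
  have h1 := mul_le_mul_of_nonneg_right hC1 hQ
  have h2 := mul_le_mul_of_nonneg_right hC2 hdir
  have h3 := mul_le_mul_of_nonneg_right hC3 hcur
  have e2 : C * (Q + a2 * (dir + cur)) = C * Q + C * (a2 * dir) + C * (a2 * cur) := by ring
  rw [e2]
  linarith

set_option maxHeartbeats 1600000 in
/-- **β ⇐ CoarseCore**: the derivative wall of the NE3 energy route follows, with explicit constant `assemblyConst` and
radius `wallRad`, from the per-plaquette core estimate.  [folklore] -/
theorem deficitDerivWall_of_coarseCore (L : ℕ) (hL : 1 ≤ L) {c₁ c₂ a₀ : ℝ} {Rb : ℕ} (hc₁ : 0 ≤ c₁) (hc₂ : 0 ≤ c₂)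
    (ha₀ : 512 * (d + 1) * (d + 4) * (L : ℝ) ^ 2 * a₀ ≤ 1) (hcore : CoarseCore d n L c₁ c₂ a₀ Rb) :
    DeficitDerivWall d n L (assemblyConst d L c₁ c₂ Rb) a₀ (wallRad d L Rb) := by
  intro V hV a ha haa₀ hVa ψ S hψ hS
  -- smallness bookkeeping
  have hK : (0 : ℝ) ≤ 512 * (d + 1) * (d + 4) * (L : ℝ) ^ 2 := by positivity
  have hsmall : 512 * (d + 1) * (d + 4) * (L : ℝ) ^ 2 * a ≤ 1 := (mul_le_mul_of_nonneg_left haa₀ hK).trans ha₀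
  have hL0 : (0 : ℝ) < L := by exact_mod_cast hL
  have ha1 : a ≤ 1 / 4 := by
    have h1 : (4 : ℝ) ≤ ((d : ℝ) + 1) * ((d : ℝ) + 4) * (L : ℝ) ^ 2 := by
      have hd0 : (0 : ℝ) ≤ d := Nat.cast_nonneg d
      have hL1 : (1 : ℝ) ≤ (L : ℝ) ^ 2 := one_le_pow₀ (by exact_mod_cast hL)
      have h1' : (4 : ℝ) ≤ ((d : ℝ) + 1) * ((d : ℝ) + 4) := by nlinarith
      calc (4 : ℝ) = 4 * 1 := by ring
        _ ≤ ((d : ℝ) + 1) * ((d : ℝ) + 4) * (L : ℝ) ^ 2 := mul_le_mul h1' hL1 (by norm_num) (by positivity)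
    have h2 := mul_le_mul_of_nonneg_right h1 ha
    have e : ((d : ℝ) + 1) * ((d : ℝ) + 4) * (L : ℝ) ^ 2 * a = (512 * (d + 1) * (d + 4) * (L : ℝ) ^ 2 * a) / 512 := by
      ring
    rw [e] at h2
    linarith
  -- the loop variables are in the ball: derivatives exist
  have hW : ∀ (q : Site d) (κ : Fin d) (r : Fin d → Fin L), ‖((Wcx L V q κ (boxVec L r) : 𝕄ˣ) : 𝕄) - 1‖ < 1 :=
    norm_Wcx_sub_one_lt_one_of_smallField L hL hV ha hsmall hVa
  -- the per-plaquette coarse derivatives and the fine derivatives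
  have ht : ∀ P : Plaq d, HasDerivAt (fun s : ℝ => wt (chol L (vary V ψ s) P))
      (deriv (fun s : ℝ => wt (chol L (vary V ψ s) P)) 0) 0 := fun P =>
    (differentiableAt_wt_comp (differentiableAt_val_chol_vary L V ψ P hW)).hasDerivAt
  have ht' : ∀ p : Plaq d, HasDerivAt (fun s : ℝ => wt (fhol (vary V ψ s) p))
      (-nReTr (curl V ψ p * ((fhol V p : 𝕄ˣ) : 𝕄))) 0 := fun p => hasDerivAt_wt_fhol_vary V ψ p
  -- locality
  have htfar : ∀ P : Plaq d, P ∉ pSet L S → deriv (fun s : ℝ => wt (chol L (vary V ψ s) P)) 0 = 0 := by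
    rintro ⟨y, π⟩ hP
    have hy : y ∉ ySet L S := fun h => hP (Finset.mem_product.mpr ⟨h, Finset.mem_univ _⟩)
    exact deriv_term_eq_zero_of_far L V hS π (far_of_not_mem_ySet L hL hy) (ht (y, π))
  have ht'far : ∀ p : Plaq d, p ∉ fSet S → -nReTr (curl V ψ p * ((fhol V p : 𝕄ˣ) : 𝕄)) = 0 := by
    rintro ⟨x, π⟩ hp
    have hx : x ∉ nbhd 4 (bondSites S) := fun h => hp (Finset.mem_product.mpr ⟨h, Finset.mem_univ _⟩)
    rw [curl_eq_zero_of_far V hS π hx, zero_mul]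
    simp [nReTr]
  -- eventuality: all windows containing `(pSet, fSet)`
  refine (eventually_ge_atTop (pSet L S, fSet S)).mono fun W hWge D hD => ?_
  have hWc : pSet L S ⊆ W.1 := hWge.1
  have hWf : fSet S ⊆ W.2 := hWge.2
  -- (i) the derivative as a sum
  have hD' : HasDerivAt (fun s : ℝ => deficit L (vary V ψ s) W)
      ((L : ℝ) ^ ((d : ℤ) - 4) * ∑ P ∈ W.1, deriv (fun s : ℝ => wt (chol L (vary V ψ s) P)) 0
        - ∑ p ∈ W.2, -nReTr (curl V ψ p * ((fhol V p : 𝕄ˣ) : 𝕄))) 0 := by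
    have h1 := HasDerivAt.fun_sum (u := W.1) fun P _ => ht P
    have h2 := HasDerivAt.fun_sum (u := W.2) fun p _ => ht' p
    have h := (h1.const_mul ((L : ℝ) ^ ((d : ℤ) - 4))).sub h2
    refine h.congr_of_eventuallyEq (Filter.Eventually.of_forall fun s => ?_)
    simp only [deficit, coarseAction, fineAction, Pi.sub_apply]
  have hDeq := hD.unique hD'
  -- (ii) restrict the sums to the index sets
  have hsumc : ∑ P ∈ W.1, deriv (fun s : ℝ => wt (chol L (vary V ψ s) P)) 0
      = ∑ P ∈ pSet L S, deriv (fun s : ℝ => wt (chol L (vary V ψ s) P)) 0 :=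
    (Finset.sum_subset hWc fun P _ hP => htfar P hP).symm
  have hsumf : ∑ p ∈ W.2, -nReTr (curl V ψ p * ((fhol V p : 𝕄ˣ) : 𝕄))
      = ∑ p ∈ fSet S, -nReTr (curl V ψ p * ((fhol V p : 𝕄ˣ) : 𝕄)) :=
    (Finset.sum_subset hWf fun p _ hp => ht'far p hp).symm
  -- (iii) the exact cancellation
  have hcancel := sum_stencilPair_eq L hL V hS
  have hzpow : (L : ℝ) ^ ((d : ℤ) - 4) * (L : ℝ) ^ ((2 : ℤ) - d) * (L : ℝ) ^ 2 = 1 := by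
    rw [← zpow_add₀ hL0.ne', show ((d : ℤ) - 4) + (2 - d) = -2 by ring, ← zpow_natCast (L : ℝ) 2,
      ← zpow_add₀ hL0.ne']
    norm_num
  have hDeq2 : D = (L : ℝ) ^ ((d : ℤ) - 4) * ∑ P ∈ pSet L S,
        (deriv (fun s : ℝ => wt (chol L (vary V ψ s) P)) 0 + (L : ℝ) ^ ((2 : ℤ) - d) * stencilPair L V ψ P.1 P.2)
      + ∑ p ∈ fSet S, (nReTr (curl V ψ p * ((fhol V p : 𝕄ˣ) : 𝕄)) - nReTr (curl V ψ p * mlog ((fhol V p : 𝕄ˣ) : 𝕄))) := by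
    rw [hDeq, hsumc, hsumf, Finset.sum_add_distrib, ← Finset.mul_sum, hcancel, Finset.sum_sub_distrib,
      Finset.sum_neg_distrib, mul_add, ← mul_assoc, ← mul_assoc, hzpow, one_mul]
    simp only [flux]
    ring
  -- (iv) termwise bounds
  have hcoarse : ∀ P ∈ pSet L S,
      |deriv (fun s : ℝ => wt (chol L (vary V ψ s) P)) 0 + (L : ℝ) ^ ((2 : ℤ) - d) * stencilPair L V ψ P.1 P.2|
      ≤ c₁ * stencilCurlL1 L V ψ P.1 P.2 * boxGradL1 L V Rb P.1 P.2
        + c₂ * a ^ 2 * (dirL1 ψ (box Rb ((L : ℤ) • P.1)) + stencilCurlL1 L V ψ P.1 P.2) := fun P _ =>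
    hcore V hV a ha haa₀ hVa ψ hψ P.1 P.2 _ (ht P)
  have hfine : ∀ p ∈ fSet S, |nReTr (curl V ψ p * ((fhol V p : 𝕄ˣ) : 𝕄)) - nReTr (curl V ψ p * mlog ((fhol V p : 𝕄ˣ) : 𝕄))|
      ≤ 4 * a ^ 2 * ‖curl V ψ p‖ := by
    rintro ⟨x, π⟩ _
    have hp : ‖((fhol V (x, π) : 𝕄ˣ) : 𝕄) - 1‖ ≤ a := hVa x π.1.1 π.1.2 (ne_of_lt π.2)
    have hsq : ‖((fhol V (x, π) : 𝕄ˣ) : 𝕄) - 1‖ ^ 2 ≤ a ^ 2 := pow_le_pow_left₀ (norm_nonneg _) hp 2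
    calc _ ≤ 4 * ‖((fhol V (x, π) : 𝕄ˣ) : 𝕄) - 1‖ ^ 2 * ‖curl V ψ (x, π)‖ :=
          abs_nReTr_mul_sub_mul_mlog_le (curl_mem_skewAdjoint hV hψ (x, π)) (hp.trans ha1)
      _ ≤ 4 * a ^ 2 * ‖curl V ψ (x, π)‖ :=
          mul_le_mul_of_nonneg_right (mul_le_mul_of_nonneg_left hsq (by norm_num)) (norm_nonneg _)
  -- (v) the summed right-hand sides against the wall functionals on `N`
  have hS3 := sum_stencilCurl_mul_boxGrad_le L hL Rb V ψ S
  have hS1 := sum_dirL1_box_le L hL Rb ψ S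
  have hS2 := sum_stencilCurlL1_le L hL Rb V ψ S
  set N : Finset (Site d) := nbhd (wallRad d L Rb) (bondSites S) with hN_def
  set Sroot : ℝ := Real.sqrt ((L : ℝ) ^ (d + 4) * (((2 * Rb + 1 : ℕ) : ℝ) ^ (2 * d) * d)) with hSroot_def
  set K₁ : ℝ := (Fintype.card (T4AveragingDeficitWall.Plane d) : ℝ) * (2 * Rb + 1) ^ d with hK₁_def
  set Q : ℝ := Real.sqrt (gradFluxSq V N) * Real.sqrt (curlSq V ψ N) with hQ_def
  have hQ : 0 ≤ Q := mul_nonneg (Real.sqrt_nonneg _) (Real.sqrt_nonneg _)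
  have hdir : 0 ≤ dirL1 ψ N := dirL1_nonneg ψ N
  have hcur : 0 ≤ curlL1 V ψ N := Finset.sum_nonneg fun _ _ => Finset.sum_nonneg fun _ _ => norm_nonneg _
  have hX : ∑ P ∈ pSet L S, stencilCurlL1 L V ψ P.1 P.2 * boxGradL1 L V Rb P.1 P.2 ≤ Sroot * Q := by
    unfold pSet
    rw [Finset.sum_product]
    refine hS3.trans (le_of_eq ?_)
    rw [Real.sqrt_mul (show (0 : ℝ) ≤ (L : ℝ) ^ (d + 4) by positivity) (curlSq V ψ N),
      Real.sqrt_mul (show (0 : ℝ) ≤ ((2 * Rb + 1 : ℕ) : ℝ) ^ (2 * d) * d by positivity) (gradFluxSq V N),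
      hSroot_def, Real.sqrt_mul (show (0 : ℝ) ≤ (L : ℝ) ^ (d + 4) by positivity)]
    ring
  have hY : ∑ P ∈ pSet L S, (dirL1 ψ (box Rb ((L : ℤ) • P.1)) + stencilCurlL1 L V ψ P.1 P.2)
      ≤ K₁ * dirL1 ψ N + (L : ℝ) ^ 2 * curlL1 V ψ N := by
    unfold pSet
    rw [Finset.sum_product]
    simp only [Finset.sum_add_distrib]
    exact add_le_add hS1 hS2
  have hZ : ∑ p ∈ fSet S, 4 * a ^ 2 * ‖curl V ψ p‖ ≤ 4 * a ^ 2 * curlL1 V ψ N := by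
    rw [← Finset.mul_sum]
    refine mul_le_mul_of_nonneg_left ?_ (by positivity)
    unfold fSet T4AveragingDeficitWall.curlL1
    rw [Finset.sum_product]
    exact Finset.sum_le_sum_of_subset_of_nonneg (nbhd4_subset_wall L Rb S)
      fun _ _ _ => Finset.sum_nonneg fun _ _ => norm_nonneg _
  have hsumP : ∑ P ∈ pSet L S, (c₁ * stencilCurlL1 L V ψ P.1 P.2 * boxGradL1 L V Rb P.1 P.2
        + c₂ * a ^ 2 * (dirL1 ψ (box Rb ((L : ℤ) • P.1)) + stencilCurlL1 L V ψ P.1 P.2))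
      ≤ c₁ * (Sroot * Q) + c₂ * a ^ 2 * (K₁ * dirL1 ψ N + (L : ℝ) ^ 2 * curlL1 V ψ N) := by
    have e1 : ∀ P : Plaq d, c₁ * stencilCurlL1 L V ψ P.1 P.2 * boxGradL1 L V Rb P.1 P.2
        + c₂ * a ^ 2 * (dirL1 ψ (box Rb ((L : ℤ) • P.1)) + stencilCurlL1 L V ψ P.1 P.2)
        = c₁ * (stencilCurlL1 L V ψ P.1 P.2 * boxGradL1 L V Rb P.1 P.2)
          + (c₂ * a ^ 2) * (dirL1 ψ (box Rb ((L : ℤ) • P.1)) + stencilCurlL1 L V ψ P.1 P.2) := fun P => by ring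
    rw [Finset.sum_congr rfl fun P _ => e1 P, Finset.sum_add_distrib, ← Finset.mul_sum, ← Finset.mul_sum]
    exact add_le_add (mul_le_mul_of_nonneg_left hX hc₁) (mul_le_mul_of_nonneg_left hY (mul_nonneg hc₂ (sq_nonneg a)))
  -- (vi) assemble
  have hLpow : (0 : ℝ) < (L : ℝ) ^ ((d : ℤ) - 4) := zpow_pos hL0 _
  have hPabs : |(L : ℝ) ^ ((d : ℤ) - 4) * ∑ P ∈ pSet L S,
        (deriv (fun s : ℝ => wt (chol L (vary V ψ s) P)) 0 + (L : ℝ) ^ ((2 : ℤ) - d) * stencilPair L V ψ P.1 P.2)|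
      ≤ (L : ℝ) ^ ((d : ℤ) - 4) * (c₁ * (Sroot * Q) + c₂ * a ^ 2 * (K₁ * dirL1 ψ N + (L : ℝ) ^ 2 * curlL1 V ψ N)) := by
    rw [abs_mul, abs_of_pos hLpow]
    exact mul_le_mul_of_nonneg_left
      ((Finset.abs_sum_le_sum_abs _ _).trans ((Finset.sum_le_sum hcoarse).trans hsumP)) hLpow.le
  have hFabs : |∑ p ∈ fSet S, (nReTr (curl V ψ p * ((fhol V p : 𝕄ˣ) : 𝕄)) - nReTr (curl V ψ p * mlog ((fhol V p : 𝕄ˣ) : 𝕄)))|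
      ≤ 4 * a ^ 2 * curlL1 V ψ N :=
    (Finset.abs_sum_le_sum_abs _ _).trans ((Finset.sum_le_sum hfine).trans hZ)
  have hSroot : 0 ≤ Sroot := Real.sqrt_nonneg _
  have hK₁ : 0 ≤ K₁ := by positivity
  have hC1 : (L : ℝ) ^ ((d : ℤ) - 4) * c₁ * Sroot ≤ assemblyConst d L c₁ c₂ Rb := by
    unfold assemblyConst
    have : 0 ≤ (L : ℝ) ^ ((d : ℤ) - 4) * (c₂ * (K₁ + (L : ℝ) ^ 2)) := by positivity
    nlinarith
  have hC2 : (L : ℝ) ^ ((d : ℤ) - 4) * c₂ * K₁ ≤ assemblyConst d L c₁ c₂ Rb := by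
    unfold assemblyConst
    have h1 : 0 ≤ (L : ℝ) ^ ((d : ℤ) - 4) * (c₁ * Sroot) := by positivity
    have h2 : 0 ≤ (L : ℝ) ^ ((d : ℤ) - 4) * (c₂ * (L : ℝ) ^ 2) := by positivity
    nlinarith
  have hC3 : (L : ℝ) ^ ((d : ℤ) - 4) * c₂ * (L : ℝ) ^ 2 + 4 ≤ assemblyConst d L c₁ c₂ Rb := by
    unfold assemblyConst
    have h1 : 0 ≤ (L : ℝ) ^ ((d : ℤ) - 4) * (c₁ * Sroot) := by positivity
    have h2 : 0 ≤ (L : ℝ) ^ ((d : ℤ) - 4) * (c₂ * K₁) := by positivity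
    nlinarith
  rw [hDeq2]
  refine (abs_add_le _ _).trans ((add_le_add hPabs hFabs).trans ?_)
  exact assembly_aux hQ (by positivity) (by positivity) hC1 hC2 hC3

end

end Summit.QuantumFields.BalabanUV.T4Continuum.AveragingDeficitDerivAssembly
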